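import Summits.AtomisticToContinuum.Crystallization.Theorems.ReggeStarCoercivityDefectFreeCrystallizesLayeredGluing13

/-!
# Part 14 of the proof of `stub_layeredGluing : LayeredGluing` (S5a, line `prestress-split-korn`, crux stmt-AtomisticToContinuum-13603); see the module docstring of the final part `ReggeStarCoercivityDefectFreeCrystallizesLayeredGluing.lean` for the overview
-/

noncomputable section

open scoped BigOperators Classical InnerProductSpace
open Filter Topology

namespace Summit.AtomisticToContinuum.Crystallization.Theorems.PrestressSplitKorn

open Summit.AtomisticToContinuum.Crystallization.Theses
open Summit.AtomisticToContinuum.Crystallization.Theses.ReggeStarCoercivity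
open Summit.AtomisticToContinuum.Crystallization.Theorems.DefectFreeCrystallizes.Negative.PredicateAPI
open Literature.MathematicalPhysics.StatisticalMechanics Literature.Geometry.DiscreteGeometry


section Sites

variable {a : ℝ} {s : ℤ → ℤ} {z : ℤ → ℝ}

section StageA

variable {a : ℝ} {s : ℤ → ℤ} {z : ℤ → ℝ} {Y : Set (EuclideanSpace ℝ (Fin 3))} {x : EuclideanSpace ℝ (Fin 3)} {xe : ℤ × ℤ × ℤ}
  {E : EuclideanSpace ℝ (Fin 3) ≃ₗᵢ[ℝ] (EuclideanSpace ℝ (Fin 3))} {a' : ℝ} {s' : ℤ → ℤ} {z' : ℤ → ℝ}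

/-- **In Case I every based template is fully ideal on its five central layers.** -/
theorem fullyCubic_of_caseI (hI : CaseI Y) (hE : ∀ q ∈ Y, ExactNear Y q) {q : EuclideanSpace ℝ (Fin 3)} {E : EuclideanSpace ℝ (Fin 3) ≃ₗᵢ[ℝ] (EuclideanSpace ℝ (Fin 3))}
    {a : ℝ} {s : ℤ → ℤ} {z : ℤ → ℝ} (hq : q ∈ Y) (hT : TemplateAt Y q E a s z) : FullyCubic a s z := by
  have hc := hI q hq E a s z hT
  obtain ⟨hbox, hs, hz0, hN1, hN2⟩ := hT
  have ha := hbox.a_pos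
  have hσ := hs 0
  set σ := s 0 with hσdef
  set t₀ := layeredPos a s z (1, 0, 0) with ht₀
  have hup0 : ((1 : ℤ), (0 : ℤ), (0 : ℤ)) ∈ nbrLabels s := mem_nbrLabels.2 (Or.inr (Or.inl (by simp [upLabels])))
  have hdn0 : ((-1 : ℤ), (0 : ℤ), (0 : ℤ)) ∈ nbrLabels s := mem_nbrLabels.2 (Or.inr (Or.inr (by simp [downLabels])))
  have hnt : ‖t₀‖ = a := norm_nbrSite_cubic hbox hs hz0 hc hup0
  have hneg1 : layeredPos a s z (-1, 0, 0) = -t₀ := by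
    have := cubicAt_neg_site hz0 hc (l := (1, 0, 0)) (by norm_num)
    simpa using this
  -- the in-layer site `σ u` and the up site `(1,-σ,0) = t₀ - σ u`
  set lam := layeredPos a s z (0, σ, 0) with hlam
  have hlamu : lam = (σ : ℝ) • triangularVec₁ a := by rw [hlam, layeredPos_layer_zero hz0]; simp
  have hdiff : t₀ - lam = layeredPos a s z (1, -σ, 0) := by
    have h := layeredPos_sub_planar (a := a) (s := s) (z := z) 1 0 0 σ 0
    simp only [Int.cast_zero, zero_smul, add_zero, zero_sub, sub_zero] at h
    rw [hlamu, ht₀]; exact h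
  have hupσ : ((1 : ℤ), -σ, (0 : ℤ)) ∈ nbrLabels s := mem_nbrLabels.2 (Or.inr (Or.inl (by simp [upLabels, hσdef])))
  have hnd : ‖t₀ - lam‖ = a := by rw [hdiff]; exact norm_nbrSite_cubic hbox hs hz0 hc hupσ
  have hlamY : ∀ τ : ℤ, (τ = 1 ∨ τ = -1) → q + E ((τ : ℝ) • lam) ∈ Y := by
    intro τ hτ
    have e : (τ : ℝ) • lam = layeredPos a s z (0, τ * σ, 0) := by
      rw [hlamu, layeredPos_layer_zero hz0]; push_cast; simp [smul_smul]
    rw [e]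
    apply hN2
    rw [norm_hexSite hbox hz0]
    · linarith [hbox.2.1]
    · rcases hτ with rfl | rfl <;> rcases hσ with h | h <;> simp [hexLabels, h]
  -- the far points `q ± E (2 t₀ - λ)` are in `Y`
  have hfar : ∀ τ : ℤ, (τ = 1 ∨ τ = -1) → q + E ((τ : ℝ) • ((2 : ℝ) • t₀ - lam)) ∈ Y := by
    intro τ hτ
    have hb : q + E ((τ : ℝ) • t₀) ∈ Y := by
      rcases hτ with rfl | rfl
      · simpa using hN2 (1, 0, 0) (by rw [← ht₀, hnt]; linarith [hbox.2.1])
      · have := hN2 (-1, 0, 0) (by rw [hneg1, norm_neg, hnt]; linarith [hbox.2.1])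
        rw [hneg1] at this; push_cast; simpa using this
    have hτabs : |(τ : ℝ)| = 1 := by rcases hτ with rfl | rfl <;> simp
    have key := caseI_antipode hI hE hb (d := E ((τ : ℝ) • (lam - t₀)))
      (by convert hlamY τ hτ using 1; rw [add_assoc, ← map_add]; congr 2; module)
      (by rw [LinearIsometryEquiv.norm_map, norm_smul, Real.norm_eq_abs, hτabs, one_mul, norm_sub_rev, hnd]; linarith [hbox.2.1])
      (by
        rw [ne_eq, LinearIsometryEquiv.map_eq_zero_iff, smul_eq_zero, not_or]
        refine ⟨by rcases hτ with rfl | rfl <;> norm_num, fun h0 => ?_⟩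
        rw [sub_eq_zero] at h0
        have := hnd; rw [← h0, sub_self, norm_zero] at this; linarith)
    convert key using 1
    rw [add_sub_assoc, ← map_sub]; congr 2; module
  -- coordinates of the far vector `2 t₀ - λ`
  have hh2 : z 1 ^ 2 = 2 / 3 * a ^ 2 := by rw [hc.2.1, mul_pow, sqrt_two_thirds_sq]
  have hF0 : ((2 : ℝ) • t₀ - lam) 0 = 0 := by
    simp only [PiLp.sub_apply, PiLp.smul_apply, smul_eq_mul, ht₀, hlamu, layeredPos_apply_zero, haggLabel_one]
    simp [triangularVec₁]; rw [← hσdef]; ring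
  have hF1 : ((2 : ℝ) • t₀ - lam) 1 = a * √3 / 2 * (2 * (σ : ℝ) / 3) := by
    simp only [PiLp.sub_apply, PiLp.smul_apply, smul_eq_mul, ht₀, hlamu, layeredPos_apply_one, haggLabel_one]
    simp [triangularVec₁]; rw [← hσdef]; ring
  have hF2 : ((2 : ℝ) • t₀ - lam) 2 = 2 * z 1 := by
    simp only [PiLp.sub_apply, PiLp.smul_apply, smul_eq_mul, ht₀, hlamu, layeredPos_apply_two]
    simp [triangularVec₁]
  have hσ2 : (σ : ℝ) ^ 2 = 1 := by rcases hσ with h | h <;> simp [h]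
  have h3 : (√3 : ℝ) ^ 2 = 3 := Real.sq_sqrt (by norm_num)
  have hn2 : ‖(2 : ℝ) • t₀ - lam‖ < 2 := by
    apply norm_lt_two_of_sq
    rw [norm_sq_fin3, hF0, hF1, hF2]
    have : (0 : ℝ) ^ 2 + (a * √3 / 2 * (2 * (σ : ℝ) / 3)) ^ 2 + (2 * z 1) ^ 2 = 3 * a ^ 2 := by
      linear_combination (a ^ 2 * (σ : ℝ) ^ 2 / 9) * h3 + (a ^ 2 / 3) * hσ2 + 4 * hh2
    rw [this]; nlinarith [hbox.2.1, hbox.1]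
  -- reading the far point of layer `±2`
  have read : ∀ τ : ℤ, (τ = 1 ∨ τ = -1) → ∃ l : ℤ × ℤ × ℤ, layeredPos a s z l = (τ : ℝ) • ((2 : ℝ) • t₀ - lam) := by
    intro τ hτ
    have hτabs : |(τ : ℝ)| = 1 := by rcases hτ with rfl | rfl <;> simp
    obtain ⟨l, hl⟩ := hN1 _ (hfar τ hτ) (by
      rw [dist_eq_norm, add_sub_cancel_left, LinearIsometryEquiv.norm_map, norm_smul, Real.norm_eq_abs, hτabs,
        one_mul]; exact hn2)
    rw [add_right_inj] at hl
    exact ⟨l, (E.injective hl).symm⟩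
  have h2h := two_sqrt_two_thirds_mem ha
  have hne : a * √3 / 2 ≠ 0 := by positivity
  -- layer `2`
  have hup : z 2 = 2 * (Real.sqrt (2 / 3) * a) ∧ s 1 = s 0 := by
    obtain ⟨⟨m, i, j⟩, hl⟩ := read 1 (Or.inl rfl)
    simp only [Int.cast_one, one_smul] at hl
    have hz : z m = 2 * (Real.sqrt (2 / 3) * a) := by
      have := congrArg (fun v : EuclideanSpace ℝ (Fin 3) => v 2) hl
      simp only [layeredPos_apply_two, hF2] at this
      rw [this, hc.2.1]
    have hm : m = 2 := hbox.eq_two_of_z_mem hz0 (by rw [hz]; exact h2h)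
    subst hm
    refine ⟨hz, ?_⟩
    have h1 := congrArg (fun v : EuclideanSpace ℝ (Fin 3) => v 1) hl
    simp only [layeredPos_apply_one, hF1, haggLabel_two] at h1
    have := mul_left_cancel₀ hne h1
    have hint : 3 * j + (s 0 + s 1) = 2 * σ := by
      have : ((3 * j + (s 0 + s 1) : ℤ) : ℝ) = ((2 * σ : ℤ) : ℝ) := by push_cast at this ⊢; linarith
      exact_mod_cast this
    rw [hσdef] at hint
    rcases hs 0 with h | h <;> rcases hs 1 with h' | h' <;> omega
  -- layer `-2`
  have hdn : z (-2) = -(2 * (Real.sqrt (2 / 3) * a)) ∧ s (-2) = s 0 := by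
    obtain ⟨⟨m, i, j⟩, hl⟩ := read (-1) (Or.inr rfl)
    simp only [Int.cast_neg, Int.cast_one, neg_smul, one_smul] at hl
    have hz : z m = -(2 * (Real.sqrt (2 / 3) * a)) := by
      have := congrArg (fun v : EuclideanSpace ℝ (Fin 3) => v 2) hl
      simp only [layeredPos_apply_two, PiLp.neg_apply, hF2] at this
      rw [this, hc.2.1]
    have hm : m = -2 := hbox.eq_neg_two_of_z_mem hz0 (by rw [hz, neg_neg]; exact h2h)
    subst hm
    refine ⟨hz, ?_⟩
    have h1 := congrArg (fun v : EuclideanSpace ℝ (Fin 3) => v 1) hl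
    simp only [layeredPos_apply_one, PiLp.neg_apply, hF1, haggLabel_neg_two, hc.1] at h1
    have h1' : a * √3 / 2 * ((j : ℝ) + ((-(s 0) - s (-2) : ℤ) : ℝ) / 3) = a * √3 / 2 * (-(2 * (σ : ℝ) / 3)) := by
      rw [h1]; ring
    have := mul_left_cancel₀ hne h1'
    have hint : 3 * j + (-(s 0) - s (-2)) = -(2 * σ) := by
      have : ((3 * j + (-(s 0) - s (-2)) : ℤ) : ℝ) = ((-(2 * σ) : ℤ) : ℝ) := by push_cast at this ⊢; linarith
      exact_mod_cast this
    rw [hσdef] at hint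
    rcases hs 0 with h | h <;> rcases hs (-2) with h' | h' <;> omega
  exact ⟨hc, hup.2, hdn.2, hup.1, hdn.1⟩

/-- **Case I, tilted in-plane neighbour**: the set is the cubic template there. -/
theorem sa_framed_of_tilted_caseI (hI : CaseI Y) (hE : ∀ q ∈ Y, ExactNear Y q) (hx : FramedAt a Y x s z)
    (hxe : xe ∈ hexLabels) (hT : TemplateAt Y (x + layeredPos a s z xe) E a' s' z')
    (htilt : E.symm (layerNormal 1) ≠ layerNormal 1 ∧ E.symm (layerNormal 1) ≠ -layerNormal 1) :
    FramedAt a Y (x + layeredPos a s z xe) (fun _ => s 0) (idealZ a) := by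
  obtain ⟨haa, hc', hc⟩ := sa_tilted_cubic hx hxe hT htilt
  subst a'
  have hbox := hx.1; have hs := hx.2.1; have hz0 := hx.2.2.1
  have hqY : x + layeredPos a s z xe ∈ Y := by
    have := hx.2.2.2.2 xe (by rw [norm_hexSite hbox hz0 hxe]; linarith [hbox.2.1])
    exact this
  have hfc' := fullyCubic_of_caseI hI hE hqY hT
  obtain ⟨φ, hφ, hinj⟩ := sa_exists_phi hx hxe hT
  have hbox' := hT.1; have hs' := hT.2.1; have hz0' := hT.2.2.1
  have hhex : ∀ l ∈ hexLabels, l ∈ nbrLabels s := fun l hl => mem_nbrLabels.2 (Or.inl hl)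
  have hmxe : -xe ∈ hexLabels := neg_mem_hexLabels hxe
  have hxne : -xe ≠ xe := by
    intro h
    have h1 := congrArg (fun l : ℤ × ℤ × ℤ => l + xe) h
    simp only [neg_add_cancel] at h1
    have : (2 : ℤ) • xe = 0 := by rw [two_smul]; exact h1.symm
    have hxe0 : xe = 0 := by
      obtain ⟨m, i, j⟩ := xe
      simp only [Prod.smul_mk, smul_eq_mul, Prod.mk_eq_zero] at this ⊢
      omega
    exact nbrLabels_ne_zero (hhex _ hxe) hxe0
  -- extend `φ` to `xe` by the antipode of the image of `-xe`
  let ψ : ℤ × ℤ × ℤ → ℤ × ℤ × ℤ := fun l => if l = xe then -φ (-xe) else φ l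
  have hψ : ∀ l ∈ nbrLabels s, ψ l ∈ nbrLabels s' ∧ E (layeredPos a s' z' (ψ l)) = layeredPos a s z l := by
    intro l hl
    by_cases h : l = xe
    · rw [h]
      simp only [ψ, if_pos rfl]
      obtain ⟨hm, he⟩ := hφ _ (hhex _ hmxe) hxne
      have hneg := cubicAt_neg_site hz0' hc' (nbrLabels_fst_le hm)
      have he' : E (layeredPos a s' z' (-φ (-xe))) = layeredPos a s z xe := by
        rw [hneg, map_neg, he, layeredPos_neg_hex hz0 hxe, neg_neg]
      refine ⟨?_, he'⟩
      have hn : ‖layeredPos a s' z' (-φ (-xe))‖ = a := by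
        rw [← LinearIsometryEquiv.norm_map E, he', norm_hexSite hbox hz0 hxe]
      have hl'0 : -φ (-xe) ≠ 0 := by
        intro h0
        rw [h0, show (0 : ℤ × ℤ × ℤ) = ((0 : ℤ), (0 : ℤ), (0 : ℤ)) from rfl, layeredPos_origin hz0', norm_zero] at hn
        linarith [hbox.a_pos]
      exact mem_nbrLabels.2 (mem_labels_of_norm_le hbox' hs' hz0' hl'0 (by linarith [hbox.2.1]))
    · simp only [ψ, if_neg h]
      exact hφ l hl h
  have hinjψ : Set.InjOn ψ (nbrLabels s) := by
    intro l₁ h₁ l₂ h₂ heq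
    have e1 := (hψ l₁ h₁).2
    have e2 := (hψ l₂ h₂).2
    rw [heq] at e1
    exact layeredPos_injective_of_inBox hbox (e1.symm.trans e2)
  have hsurj : ∀ l' ∈ nbrLabels s', ∃ l ∈ nbrLabels s, ψ l = l' := by
    have himg : (nbrLabels s).image ψ = nbrLabels s' := by
      apply Finset.eq_of_subset_of_card_le
      · intro l' hl'
        obtain ⟨l, hl, rfl⟩ := Finset.mem_image.1 hl'
        exact (hψ l hl).1
      · rw [Finset.card_image_of_injOn hinjψ, card_nbrLabels hs, card_nbrLabels hs']
    intro l' hl'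
    rw [← himg] at hl'
    obtain ⟨l, hl, rfl⟩ := Finset.mem_image.1 hl'
    exact ⟨l, hl, rfl⟩
  exact framed_of_tilted_core hbox hs hz0 hc hT hfc' hψ hsurj

/-- **The in-plane step.** From a framed point one steps to each of its six in-layer neighbours,
provided either the base data are not cubic-ideal or Case I holds. -/
theorem inplane_step (hE : ∀ q ∈ Y, ExactNear Y q) (hcase : ¬ CubicAt a s z ∨ CaseI Y)
    (hx : FramedAt a Y x s z) (hxe : xe ∈ hexLabels) :
    ∃ (s'' : ℤ → ℤ) (z'' : ℤ → ℝ), FramedAt a Y (x + layeredPos a s z xe) s'' z'' := by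
  have hqY : x + layeredPos a s z xe ∈ Y :=
    hx.2.2.2.2 xe (by rw [norm_hexSite hx.1 hx.2.2.1 hxe]; linarith [hx.1.2.1])
  obtain ⟨E, a', s', z', hT⟩ := exactNear_templateAt (hE _ hqY) hqY
  by_cases hvert : E.symm (layerNormal 1) = layerNormal 1 ∨ E.symm (layerNormal 1) = -layerNormal 1
  · exact sa_framed_of_vertical hx hxe hT hvert
  · have htilt := not_or.1 hvert
    rcases hcase with hnc | hI
    · exact absurd (sa_tilted_cubic hx hxe hT htilt).2.2 hnc
    · exact ⟨_, _, sa_framed_of_tilted_caseI hI hE hx hxe hT htilt⟩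

/-- **Stage A.** From one identity-framed point the whole layer is framed (Case II with non-cubic
base data, or Case I). -/
theorem layerFramed_of_framed (hE : ∀ q ∈ Y, ExactNear Y q) {p₀ : EuclideanSpace ℝ (Fin 3)} (hp : FramedAt a Y p₀ s z)
    (hcase : ¬ CubicAt a s z ∨ CaseI Y) : LayerFramed a Y p₀ := by
  -- invariant: framed with the same first-layer data as `p₀`
  have P_case : ∀ {s' : ℤ → ℤ} {z' : ℤ → ℝ}, (z' 1 = z 1 ∧ s' 0 = s 0 ∧ z' (-1) = z (-1) ∧ s' (-1) = s (-1)) →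
      (¬ CubicAt a s' z' ∨ CaseI Y) := by
    intro s' z' hd
    rcases hcase with hnc | hI
    · left
      intro hc
      apply hnc
      exact ⟨by rw [← hd.2.2.2, ← hd.2.1]; exact hc.1, by rw [← hd.1]; exact hc.2.1, by rw [← hd.2.2.1]; exact hc.2.2⟩
    · exact Or.inr hI
  have hu : ((0 : ℤ), (1 : ℤ), (0 : ℤ)) ∈ hexLabels := by decide
  have hnu : ((0 : ℤ), (-1 : ℤ), (0 : ℤ)) ∈ hexLabels := by decide
  have hv : ((0 : ℤ), (0 : ℤ), (1 : ℤ)) ∈ hexLabels := by decide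
  have hnv : ((0 : ℤ), (0 : ℤ), (-1 : ℤ)) ∈ hexLabels := by decide
  -- one step in direction `±u, ±v` keeping the invariant
  have step : ∀ (y : EuclideanSpace ℝ (Fin 3)) (ye : ℤ × ℤ × ℤ), (ye = (0, 1, 0) ∨ ye = (0, -1, 0) ∨ ye = (0, 0, 1) ∨ ye = (0, 0, -1)) →
      ∀ {sy : ℤ → ℤ} {zy : ℤ → ℝ}, FramedAt a Y y sy zy →
      (zy 1 = z 1 ∧ sy 0 = s 0 ∧ zy (-1) = z (-1) ∧ sy (-1) = s (-1)) →
      ∃ (s'' : ℤ → ℤ) (z'' : ℤ → ℝ), FramedAt a Y (y + layeredPos a sy zy ye) s'' z'' ∧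
        (z'' 1 = z 1 ∧ s'' 0 = s 0 ∧ z'' (-1) = z (-1) ∧ s'' (-1) = s (-1)) := by
    intro y ye hye4 sy zy hy hd
    have hye : ye ∈ hexLabels := by rcases hye4 with rfl | rfl | rfl | rfl <;> decide
    obtain ⟨s'', z'', h''⟩ := inplane_step hE (P_case hd) hy hye
    refine ⟨s'', z'', h'', ?_⟩
    have he0 : layeredPos a sy zy ye = ((ye.2.1 : ℝ) • triangularVec₁ a + (ye.2.2 : ℝ) • triangularVec₂ a) :=
      layeredPos_of_mem_hexLabels hy.2.2.1 hye
    have h3 := h''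
    rw [he0] at h3
    rcases hye4 with rfl | rfl | rfl | rfl
    · simp only [Int.cast_one, one_smul, Int.cast_zero, zero_smul, add_zero] at h3
      have k := framed_data_eq (Or.inr (Or.inl rfl)) hy h3
      exact ⟨k.1.trans hd.1, k.2.1.trans hd.2.1, k.2.2.1.trans hd.2.2.1, k.2.2.2.trans hd.2.2.2⟩
    · simp only [Int.cast_neg, Int.cast_one, neg_smul, one_smul, Int.cast_zero, zero_smul, add_zero] at h3
      have hy' : FramedAt a Y (y + -triangularVec₁ a + triangularVec₁ a) sy zy := by
        rw [neg_add_cancel_right]; exact hy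
      have k := framed_data_eq (Or.inr (Or.inl rfl)) h3 hy'
      exact ⟨k.1.symm.trans hd.1, k.2.1.symm.trans hd.2.1, k.2.2.1.symm.trans hd.2.2.1, k.2.2.2.symm.trans hd.2.2.2⟩
    · simp only [Int.cast_one, one_smul, Int.cast_zero, zero_smul, zero_add] at h3
      have k := framed_data_eq (Or.inr (Or.inr rfl)) hy h3
      exact ⟨k.1.trans hd.1, k.2.1.trans hd.2.1, k.2.2.1.trans hd.2.2.1, k.2.2.2.trans hd.2.2.2⟩
    · simp only [Int.cast_neg, Int.cast_one, neg_smul, one_smul, Int.cast_zero, zero_smul, zero_add] at h3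
      have hy' : FramedAt a Y (y + -triangularVec₂ a + triangularVec₂ a) sy zy := by
        rw [neg_add_cancel_right]; exact hy
      have k := framed_data_eq (Or.inr (Or.inr rfl)) h3 hy'
      exact ⟨k.1.symm.trans hd.1, k.2.1.symm.trans hd.2.1, k.2.2.1.symm.trans hd.2.2.1, k.2.2.2.symm.trans hd.2.2.2⟩
  -- sites of the four unit steps
  have site_u : ∀ {sy : ℤ → ℤ} {zy : ℤ → ℝ}, zy 0 = 0 → layeredPos a sy zy (0, 1, 0) = triangularVec₁ a :=
    fun h => by rw [layeredPos_layer_zero h]; simp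
  have site_nu : ∀ {sy : ℤ → ℤ} {zy : ℤ → ℝ}, zy 0 = 0 → layeredPos a sy zy (0, -1, 0) = -triangularVec₁ a :=
    fun h => by rw [layeredPos_layer_zero h]; simp
  have site_v : ∀ {sy : ℤ → ℤ} {zy : ℤ → ℝ}, zy 0 = 0 → layeredPos a sy zy (0, 0, 1) = triangularVec₂ a :=
    fun h => by rw [layeredPos_layer_zero h]; simp
  have site_nv : ∀ {sy : ℤ → ℤ} {zy : ℤ → ℝ}, zy 0 = 0 → layeredPos a sy zy (0, 0, -1) = -triangularVec₂ a :=
    fun h => by rw [layeredPos_layer_zero h]; simp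
  -- along `u`
  have hi : ∀ i : ℤ, ∃ (sy : ℤ → ℤ) (zy : ℤ → ℝ), FramedAt a Y (p₀ + (i : ℝ) • triangularVec₁ a) sy zy ∧
      (zy 1 = z 1 ∧ sy 0 = s 0 ∧ zy (-1) = z (-1) ∧ sy (-1) = s (-1)) := by
    intro i
    induction i using Int.induction_on with
    | zero => exact ⟨s, z, by simpa using hp, rfl, rfl, rfl, rfl⟩
    | succ n ih =>
      obtain ⟨sy, zy, hy, hd⟩ := ih
      obtain ⟨s'', z'', h'', hd''⟩ := step _ (0, 1, 0) (Or.inl rfl) hy hd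
      rw [site_u hy.2.2.1] at h''
      refine ⟨s'', z'', ?_, hd''⟩
      have e : p₀ + (((n : ℤ) + 1 : ℤ) : ℝ) • triangularVec₁ a = p₀ + ((n : ℤ) : ℝ) • triangularVec₁ a + triangularVec₁ a := by
        push_cast; module
      rw [e]; exact h''
    | pred n ih =>
      obtain ⟨sy, zy, hy, hd⟩ := ih
      obtain ⟨s'', z'', h'', hd''⟩ := step _ (0, -1, 0) (Or.inr (Or.inl rfl)) hy hd
      rw [site_nu hy.2.2.1] at h''
      refine ⟨s'', z'', ?_, hd''⟩
      have e : p₀ + ((-(n : ℤ) - 1 : ℤ) : ℝ) • triangularVec₁ a = p₀ + ((-(n : ℤ) : ℤ) : ℝ) • triangularVec₁ a + -triangularVec₁ a := by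
        push_cast; module
      rw [e]; exact h''
  -- along `v`
  intro i j
  obtain ⟨s₁, z₁, h₁, hd₁⟩ := hi i
  have hj : ∀ j : ℤ, ∃ (sy : ℤ → ℤ) (zy : ℤ → ℝ),
      FramedAt a Y (p₀ + (i : ℝ) • triangularVec₁ a + (j : ℝ) • triangularVec₂ a) sy zy ∧
      (zy 1 = z 1 ∧ sy 0 = s 0 ∧ zy (-1) = z (-1) ∧ sy (-1) = s (-1)) := by
    intro j
    induction j using Int.induction_on with
    | zero => exact ⟨s₁, z₁, by simpa using h₁, hd₁⟩
    | succ n ih =>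
      obtain ⟨sy, zy, hy, hd⟩ := ih
      obtain ⟨s'', z'', h'', hd''⟩ := step _ (0, 0, 1) (Or.inr (Or.inr (Or.inl rfl))) hy hd
      rw [site_v hy.2.2.1] at h''
      refine ⟨s'', z'', ?_, hd''⟩
      have e : p₀ + (i : ℝ) • triangularVec₁ a + (((n : ℤ) + 1 : ℤ) : ℝ) • triangularVec₂ a =
          p₀ + (i : ℝ) • triangularVec₁ a + ((n : ℤ) : ℝ) • triangularVec₂ a + triangularVec₂ a := by
        push_cast; module
      rw [e]; exact h''
    | pred n ih =>
      obtain ⟨sy, zy, hy, hd⟩ := ih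
      obtain ⟨s'', z'', h'', hd''⟩ := step _ (0, 0, -1) (Or.inr (Or.inr (Or.inr rfl))) hy hd
      rw [site_nv hy.2.2.1] at h''
      refine ⟨s'', z'', ?_, hd''⟩
      have e : p₀ + (i : ℝ) • triangularVec₁ a + ((-(n : ℤ) - 1 : ℤ) : ℝ) • triangularVec₂ a =
          p₀ + (i : ℝ) • triangularVec₁ a + ((-(n : ℤ) : ℤ) : ℝ) • triangularVec₂ a + -triangularVec₂ a := by
        push_cast; module
      rw [e]; exact h''
  obtain ⟨sy, zy, hy, -⟩ := hj j
  refine ⟨sy, zy, ?_⟩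
  have e : p₀ + ((i : ℝ) • triangularVec₁ a + (j : ℝ) • triangularVec₂ a) =
      p₀ + (i : ℝ) • triangularVec₁ a + (j : ℝ) • triangularVec₂ a := by module
  rw [e]; exact hy

end StageA

/-! ## Assembly: exact rigidity and the gluing lemma -/

section Assembly

/-- Auxiliary step `TemplateAt.map` of the proof of `stub_layeredGluing` (S5a); see the final part's module docstring. -/
theorem TemplateAt.map {Y : Set (EuclideanSpace ℝ (Fin 3))} {q : EuclideanSpace ℝ (Fin 3)} {E₁ : EuclideanSpace ℝ (Fin 3) ≃ₗᵢ[ℝ] (EuclideanSpace ℝ (Fin 3))} {a : ℝ} {s : ℤ → ℤ} {z : ℤ → ℝ}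
    (h : TemplateAt Y q E₁ a s z) (R : EuclideanSpace ℝ (Fin 3) ≃ₗᵢ[ℝ] (EuclideanSpace ℝ (Fin 3))) (c : EuclideanSpace ℝ (Fin 3)) :
    TemplateAt ((fun y => R y + c) '' Y) (R q + c) (E₁.trans R) a s z := by
  obtain ⟨hbox, hs, hz0, h1, h2⟩ := h
  refine ⟨hbox, hs, hz0, ?_, ?_⟩
  · rintro _ ⟨y, hy, rfl⟩ hd
    have hd' : dist y q < 2 := by
      rw [dist_eq_norm] at hd ⊢
      rw [show R y + c - (R q + c) = R (y - q) by rw [map_sub]; abel, LinearIsometryEquiv.norm_map] at hd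
      exact hd
    obtain ⟨l, hl⟩ := h1 y hy hd'
    refine ⟨l, ?_⟩
    show R y + c = R q + c + (E₁.trans R) (layeredPos a s z l)
    rw [hl, map_add, LinearIsometryEquiv.trans_apply]; abel
  · intro l hl
    refine ⟨q + E₁ (layeredPos a s z l), h2 l hl, ?_⟩
    show R (q + E₁ (layeredPos a s z l)) + c = R q + c + (E₁.trans R) (layeredPos a s z l)
    rw [map_add, LinearIsometryEquiv.trans_apply]; abel

/-- Landing anchor of this file (registered stub of crux stmt-AtomisticToContinuum-13603; re-exports a result above). -/
theorem layeredGluing_part14_anchor :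
    ∀ (Y : Set (EuclideanSpace ℝ (Fin 3))), (∀ q ∈ Y, ExactNear Y q) → ∀ (a : ℝ) (s : ℤ → ℤ) (z : ℤ → ℝ) (p₀ : EuclideanSpace ℝ (Fin 3)), FramedAt a Y p₀ s z → (¬ CubicAt a s z ∨ CaseI Y) → LayerFramed a Y p₀ :=
  fun _ hE _ _ _ _ hp hc => layerFramed_of_framed hE hp hc

end Assembly
end Sites

end Summit.AtomisticToContinuum.Crystallization.Theorems.PrestressSplitKorn
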